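import Summits.ABC.IUTFork.Thm311RealInd2IsmSignature
import Summits.ABC.IUTFork.Thm311RealInd2IsmScalar
import HarnessLib

/-!
# [IUTchIII] Theorem 3.11 (i) (Ind2), print-literal at `𝕍^non`: the rigidity theorems READ ON c312-5's CARRIER
# (`Real.Carrier (inr v)`, `Real.integers v`, a log-binder `logv : PadicLogs F`) — the form the adjudication teams cite

Record file (D-0012) of the abc-iut cell (seat abc-iut-c312-1, holder of record of the typed [IUTchIII] Thm. 3.11,
gen 7); corollary sheet of `Thm311RealInd2IsmSignature` / `…Rigid` / `…Scalar`; TAKES NO SIDE on [IUTchIII] Cor. 3.12.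

Team R / C-cert / the hull-volume files quantify over `φ ∈ Real.ismDH logv (inr v)` — `ℚ`-linear automorphisms of
`Real.Carrier (inr v) = K_v`.  For the PRINT-LITERAL (Ind2)-group `Real.ismIsm logv v ⊆ Real.ismDH logv (inr v)`
(`ismIsm_subset_ismDH`) this file restates, in exactly that vocabulary:
* **`Real.image_eq_of_mem_ismIsm`** — every `ψ ∈ Real.ismIsm logv v` FIXES (as a set) every additive subgroup `M` with
  `n·Λ ⊆ M ⊆ Λ := log_v(𝒪_v^×)` (`n ≠ 0`);
* **`Real.image_smul_eq_of_mem_ismIsm`** — hence also every `ℚ`-rescaling `q·M` of such an `M` (e.g. the sub-lattices of the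
  log-shell `I_v = (p_v^*)⁻¹·Λ` sandwiched between `(p_v^*)⁻¹·n·Λ` and `I_v`);
* **`Real.exists_zsmul_add_nsmul_of_mem_ismIsm`** — `ψ(log_v u) = k·log_v u + n·log_v u'`: an INTEGER SCALAR modulo `n·Λ`
  on every direction, every `n ≠ 0`;
* **`Real.not_mem_ismIsm_of_moves_direction`** — the NO-SHEAR criterion.
So, in the cell's words: a `φ ∈ Real.ismDH logv (inr v)` that moves a sandwiched sub-lattice box (the lattice shears
`1 ↦ π/p` available when `e(v|p) ≥ 2`, abc-iut-c312-5 `exists_mem_ismDH_image_closedBall_ne`, abc-iut-c312-3's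
shallow-ramified licence mover) is NOT in print's (Ind2)-group.  [claim: Mochizuki2012, status: disputed] for the (Ind2)
quotation ([IUTchIII] Thm. 3.11 (i) p. 154 l. 55–60; [IUTchII] Ex. 1.8 (iv) p. 39); [cite: SerreLocalFields1979, Ch. XIV §6 Thm. 1].
typed ≠ proved; instantiated ≠ endorsed; no side taken.
-/

set_option autoImplicit false

noncomputable section

namespace Summit.ABC.IUTFork.Thm311.Real

open NumberField IsDedekindDomain Literature.IUT.LogVolume Literature.IUT.LogThetaLattice
open scoped Pointwise

variable {F : Type} [Field F] [NumberField F] (logv : PadicLogs F) (v : HeightOneSpectrum (𝓞 F))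

/-- **Every element of print's (Ind2)-group at `v` fixes every sub-lattice between `n·Λ` and `Λ = log_v(𝒪_v^×)`** (c312-5's
carrier and log-binder; `n ≠ 0`). [cite: SerreLocalFields1979, Ch. XIV §6 Thm. 1] [claim: Mochizuki2012, status: disputed] -/
theorem image_eq_of_mem_ismIsm {ψ : Carrier (.inr v : Place F) ≃ₗ[ℚ] Carrier (.inr v : Place F)} (hψ : ψ ∈ ismIsm logv v)
    {n : ℕ} (hn : n ≠ 0) (M : AddSubgroup (Carrier (.inr v : Place F)))
    (hM : (M : Set (Carrier (.inr v : Place F))) ⊆ Set.range fun u : (↥(integers (F := F) v))ˣ => logv v (Additive.ofMul u))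
    (hnM : ∀ u : (↥(integers (F := F) v))ˣ, n • logv v (Additive.ofMul u) ∈ M) :
    ψ '' (M : Set (Carrier (.inr v : Place F))) = M := by
  obtain ⟨-, -, φ, hφ, hr⟩ := hψ
  exact image_eq_of_realises_of_nsmul_mem (logv v) hφ hr hn M hM hnM

/-- … and every `ℚ`-rescaling `q • M` of such a sub-lattice (`ψ` is `ℚ`-linear): e.g. the sandwiched sub-lattices of the
log-shell `I_v = (p_v^*)⁻¹·Λ`. [cite: SerreLocalFields1979, Ch. XIV §6 Thm. 1] [claim: Mochizuki2012, status: disputed] -/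
theorem image_smul_eq_of_mem_ismIsm {ψ : Carrier (.inr v : Place F) ≃ₗ[ℚ] Carrier (.inr v : Place F)} (hψ : ψ ∈ ismIsm logv v)
    {n : ℕ} (hn : n ≠ 0) (M : AddSubgroup (Carrier (.inr v : Place F)))
    (hM : (M : Set (Carrier (.inr v : Place F))) ⊆ Set.range fun u : (↥(integers (F := F) v))ˣ => logv v (Additive.ofMul u))
    (hnM : ∀ u : (↥(integers (F := F) v))ˣ, n • logv v (Additive.ofMul u) ∈ M) (q : ℚ) :
    ψ '' (q • (M : Set (Carrier (.inr v : Place F)))) = q • (M : Set (Carrier (.inr v : Place F))) := by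
  have h := image_eq_of_mem_ismIsm logv v hψ hn M hM hnM
  ext y
  constructor
  · rintro ⟨x, hx, rfl⟩
    obtain ⟨m, hm, rfl⟩ := Set.mem_smul_set.mp hx
    have hψm : ψ m ∈ (M : Set (Carrier (.inr v : Place F))) := by rw [← h]; exact ⟨m, hm, rfl⟩
    exact Set.mem_smul_set.mpr ⟨ψ m, hψm, (map_smul ψ q m).symm⟩
  · intro hy
    obtain ⟨m', hm', rfl⟩ := Set.mem_smul_set.mp hy
    have hm'' : m' ∈ ψ '' (M : Set (Carrier (.inr v : Place F))) := by rw [h]; exact hm'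
    obtain ⟨m, hm, rfl⟩ := hm''
    exact ⟨q • m, Set.smul_mem_smul_set hm, map_smul ψ q m⟩

/-- **Print's (Ind2) at `v` is an INTEGER SCALAR modulo `n·Λ` on every direction of the log-lattice** (c312-5's carrier).
[cite: SerreLocalFields1979, Ch. XIV §6 Thm. 1] [claim: Mochizuki2012, status: disputed] -/
theorem exists_zsmul_add_nsmul_of_mem_ismIsm {ψ : Carrier (.inr v : Place F) ≃ₗ[ℚ] Carrier (.inr v : Place F)}
    (hψ : ψ ∈ ismIsm logv v) {n : ℕ} (hn : n ≠ 0) (u : (↥(integers (F := F) v))ˣ) :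
    ∃ (k : ℤ) (u' : (↥(integers (F := F) v))ˣ),
      ψ (logv v (Additive.ofMul u)) = k • logv v (Additive.ofMul u) + n • logv v (Additive.ofMul u') :=
  exists_zsmul_add_nsmul_of_mem_ismIsmOf (logv v) hψ hn u

/-- **NO-SHEAR CRITERION on c312-5's carrier**: a `ℚ`-linear automorphism of `K_v` moving some direction of the log-lattice
modulo some `n ≠ 0` is NOT in print's (Ind2)-group `Real.ismIsm logv v` — whatever it does to `I_v` (so it may well lie in
Dupuy–Hilado's `Real.ismDH logv (inr v)`). [cite: SerreLocalFields1979, Ch. XIV §6 Thm. 1] [claim: Mochizuki2012, status: disputed] -/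
theorem not_mem_ismIsm_of_moves_direction {ψ : Carrier (.inr v : Place F) ≃ₗ[ℚ] Carrier (.inr v : Place F)} {n : ℕ}
    (hn : n ≠ 0) (u : (↥(integers (F := F) v))ˣ)
    (hmove : ∀ (k : ℤ) (u' : (↥(integers (F := F) v))ˣ),
      ψ (logv v (Additive.ofMul u)) ≠ k • logv v (Additive.ofMul u) + n • logv v (Additive.ofMul u')) :
    ψ ∉ ismIsm logv v := fun h => by
  obtain ⟨k, u', hk⟩ := exists_zsmul_add_nsmul_of_mem_ismIsm logv v h hn u
  exact hmove k u' hk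

end Summit.ABC.IUTFork.Thm311.Real

end
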